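import Literature.NumberTheory.Transcendental.CalegariDimitrovTangL2Chi3
import Literature.NumberTheory.Transcendental.LindemannWeierstrassProofs
import Mathlib.LinearAlgebra.LinearIndependent.Lemmas
import Mathlib.Tactic
import HarnessLib

/-!
# Calegari–Dimitrov–Tang, Theorem 1 — the unconditional `π²`-slice and the reduction to
`L(2, χ₋₃) ∉ ℚ + ℚπ²`

Sibling of `CalegariDimitrovTangL2Chi3.lean` (the named fact
`Literature.NumberTheory.Transcendental.calegariDimitrovTang_linearIndependent`, CDT 2024
Thm. 1: `1, π², L(2, χ₋₃)` are `ℚ`-linearly independent) and of the proof-side files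
`CalegariDimitrovTangL2Chi3Proofs.lean` / `…Overconvergence.lean` (bricks of the printed
holonomy-bound proof). This file records, PROVED, the part of Theorem 1 that the tree already
supports and the exact shape of what remains:

* `CalegariDimitrovTang.irrational_pi_sq` — **`π²` is irrational** (Legendre 1794; CDT p. 3:
  "Legendre's proof in 1794 that `π²` is irrational"), here unconditionally from the tree's
  Lindemann theorem `Literature.NumberTheory.Transcendental.transcendental_pi_holds`
  (`π² = q ∈ ℚ` would make `π` a root of `X² − q`). In `CalegariDimitrovTangL2Chi3.lean` the same
  statement (`calegariDimitrovTang_linearIndependent.irrational_pi_sq`) is only derived *from* the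
  fact.
* `CalegariDimitrovTang.linearIndependent_one_pi_sq` — the sub-family `1, π²` of Theorem 1 is
  `ℚ`-linearly independent (unconditional).
* `CalegariDimitrovTang.linearIndependent_iff_forall_ne` — **the reduction**: Theorem 1 holds iff
  `L(2, χ₋₃) ≠ p + q·π²` for all rationals `p, q`, i.e. iff `L(2,χ₋₃) ∉ ℚ + ℚπ²`. This is the
  decomposition "Thm 1 = (`1, π²` independent) ∧ (`L(2,χ₋₃)` is not in their span)", with the
  first conjunct discharged here; the second conjunct is the entire content of CDT's paper.
* `CalegariDimitrovTang.linearIndependent_iff_forall_int`,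
  `CalegariDimitrovTang.linearIndependent_of_forall_int` — the printed opening of the proof
  (§13, eq. (absurd), p. 106): a `ℚ`-linear relation "which we could write as
  `a + b · L(2,χ₋₃)/2 + c · ζ(2)/4 = 0` with some rational integers `a, b, c ∈ ℤ`, not all
  zero" (`ζ(2) = π²/6`; the normalisation `L/2`, `ζ(2)/4` is that of the Apéry limits
  `b_n/a_n → L(2,χ₋₃)/2`, `c_n/a_n → ζ(2)/4` of §11.1). Theorem 1 is equivalent to the absence of
  such relations, and — by the `π²`-slice — it suffices to refute those with `b ≠ 0`; this is
  the entry point a completed formalisation of §§9–13, 16 would plug into.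

No named facts are introduced (D-0026); nothing here is conditional.

## References

* [CalegariDimitrovTang2024] F. Calegari, V. Dimitrov, Y. Tang, *The linear independence of `1`,
  `ζ(2)`, and `L(2,χ₋₃)`*, arXiv:2408.15403 — Thm. 1 and the remark on Legendre (p. 3); §13,
  eq. (absurd) (p. 106).
* [Lindemann1882] F. Lindemann, *Über die Zahl `π`*, Math. Ann. 20 (1882) — via
  `LindemannWeierstrassProofs.lean`.
-/

noncomputable section

open Real

namespace Literature.NumberTheory.Transcendental

namespace CalegariDimitrovTang

/-! ### The `π²`-slice of Theorem 1, unconditionally -/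

/-- **`π²` is irrational** (Legendre 1794), unconditionally: if `π² = q ∈ ℚ` then `π²` is
algebraic over `ℚ`, hence so is `π` (`IsAlgebraic.of_pow`), contradicting Lindemann's theorem
(`transcendental_pi_holds`, proved in the tree). CDT recall it as the last irrationality result
on `ψ₁(n/6)`-values before theirs. [cite: CalegariDimitrovTang2024, §1.1 after Cor. 2 (p. 3)] -/
theorem irrational_pi_sq : Irrational (Real.pi ^ 2) := by
  rintro ⟨q, hq⟩
  have halg : IsAlgebraic ℚ (Real.pi ^ 2) := by
    rw [← hq]
    exact isAlgebraic_algebraMap q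
  exact transcendental_pi_holds (halg.of_pow two_pos)

/-- **The sub-family `1, π²` of Theorem 1 is `ℚ`-linearly independent** (unconditional; a
relation `s + t·π² = 0` with `t ≠ 0` would make `π² = −s/t` rational).
[cite: CalegariDimitrovTang2024, Thm. 1 (p. 3)] -/
theorem linearIndependent_one_pi_sq : LinearIndependent ℚ ![(1 : ℝ), Real.pi ^ 2] := by
  refine LinearIndependent.pair_iff.mpr fun s t hst => ?_
  simp only [Rat.smul_def, mul_one] at hst
  by_cases ht : t = 0
  · subst ht
    simp only [Rat.cast_zero, zero_mul, add_zero, Rat.cast_eq_zero] at hst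
    exact ⟨hst, rfl⟩
  · exfalso
    refine irrational_pi_sq ⟨-s / t, ?_⟩
    have ht' : (t : ℝ) ≠ 0 := by exact_mod_cast ht
    push_cast
    field_simp
    linarith

/-- Coefficient form of `linearIndependent_one_pi_sq`: `p + q·π² = 0` with `p, q ∈ ℚ` forces
`p = q = 0`. [cite: CalegariDimitrovTang2024, Thm. 1 (p. 3)] -/
theorem eq_zero_of_add_mul_pi_sq_eq_zero (p q : ℚ) (h : (p : ℝ) + q * Real.pi ^ 2 = 0) :
    p = 0 ∧ q = 0 :=
  LinearIndependent.pair_iff.mp linearIndependent_one_pi_sq p q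
    (by simpa only [Rat.smul_def, mul_one] using h)

/-! ### The reduction: Theorem 1 ⟺ `L(2, χ₋₃) ∉ ℚ + ℚπ²` -/

/-- **Reduction of Theorem 1 to its `L(2,χ₋₃)`-content.** CDT's Theorem 1 (the named fact
`calegariDimitrovTang_linearIndependent`) holds iff `L(2, χ₋₃) ≠ p + q·π²` for all rationals
`p, q`. (`⇒`: such an identity is the relation `p·1 + q·π² − L = 0`. `⇐`: in a relation
`g₀ + g₁π² + g₂L = 0`, either `g₂ ≠ 0` and `L = −g₀/g₂ − (g₁/g₂)π²`, or `g₂ = 0` and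
`linearIndependent_one_pi_sq` gives `g₀ = g₁ = 0`.) The right-hand side is exactly what the
holonomy-bound argument of CDT §13 refutes. [cite: CalegariDimitrovTang2024, Thm. 1 (p. 3) and §13 (p. 106)] -/
theorem linearIndependent_iff_forall_ne :
    calegariDimitrovTang_linearIndependent ↔ ∀ p q : ℚ, L2chi3 ≠ (p : ℝ) + q * Real.pi ^ 2 := by
  constructor
  · intro h p q hpq
    have := (h.eq_zero p q (-1) (by rw [hpq]; push_cast; ring)).2.2
    norm_num at this
  · intro h
    rw [calegariDimitrovTang_linearIndependent_iff, Fintype.linearIndependent_iff]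
    intro g hg
    rw [Fin.sum_univ_three] at hg
    simp only [Matrix.cons_val_zero, Matrix.cons_val_one, Matrix.cons_val, Rat.smul_def,
      mul_one] at hg
    -- `hg : g 0 + g 1 * π ^ 2 + g 2 * L2chi3 = 0`
    by_cases h2 : g 2 = 0
    · rw [h2, Rat.cast_zero, zero_mul, add_zero] at hg
      obtain ⟨h0, h1⟩ := eq_zero_of_add_mul_pi_sq_eq_zero (g 0) (g 1) hg
      intro i
      fin_cases i
      · exact h0
      · exact h1
      · exact h2
    · exfalso
      have h2' : ((g 2 : ℚ) : ℝ) ≠ 0 := by exact_mod_cast h2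
      refine h (-g 0 / g 2) (-g 1 / g 2) ?_
      push_cast
      field_simp
      linear_combination hg

/-- **Theorem 1 ⟹ `L(2,χ₋₃) ∉ ℚ + ℚπ²`** (the forward direction, as an implication from the
fact taken as a hypothesis). [cite: CalegariDimitrovTang2024, Thm. 1 (p. 3)] -/
theorem _root_.Literature.NumberTheory.Transcendental.calegariDimitrovTang_linearIndependent.L2chi3_ne
    (h : calegariDimitrovTang_linearIndependent) (p q : ℚ) :
    L2chi3 ≠ (p : ℝ) + q * Real.pi ^ 2 :=
  linearIndependent_iff_forall_ne.mp h p q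

/-! ### The printed form of a putative relation: `a + b·L(2,χ₋₃)/2 + c·ζ(2)/4 = 0`, `a,b,c ∈ ℤ` -/

/-- **CDT §13, eq. (absurd).** Theorem 1 is equivalent to: every relation
`a + b · L(2,χ₋₃)/2 + c · ζ(2)/4 = 0` with rational integers `a, b, c` (`ζ(2) = π²/6`) is
trivial. (Clearing denominators turns a rational relation into an integral one; the factors
`1/2`, `1/4` are harmless rescalings.) [cite: CalegariDimitrovTang2024, §13, eq. (absurd) (p. 106)] -/
theorem linearIndependent_iff_forall_int :
    calegariDimitrovTang_linearIndependent ↔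
      ∀ a b c : ℤ, (a : ℝ) + b * (L2chi3 / 2) + c * (Real.pi ^ 2 / 6 / 4) = 0 →
        a = 0 ∧ b = 0 ∧ c = 0 := by
  constructor
  · intro h a b c habc
    have h3 := h.eq_zero a (c / 24) (b / 2) (by push_cast; linear_combination habc)
    refine ⟨by exact_mod_cast h3.1, ?_, ?_⟩
    · have := h3.2.2
      simpa using this
    · have := h3.2.1
      simpa using this
  · intro H
    rw [linearIndependent_iff_forall_ne]
    intro p q hpq
    -- clear denominators: `a = -p.num·q.den`, `b = 2·p.den·q.den`, `c = -24·q.num·p.den`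
    have hp : (p : ℝ) * p.den = p.num := by exact_mod_cast Rat.mul_den_eq_num p
    have hq : (q : ℝ) * q.den = q.num := by exact_mod_cast Rat.mul_den_eq_num q
    have hrel : ((-(p.num * q.den) : ℤ) : ℝ) + ((2 * p.den * q.den : ℕ) : ℤ) * (L2chi3 / 2)
        + ((-(24 * q.num * p.den) : ℤ)) * (Real.pi ^ 2 / 6 / 4) = 0 := by
      push_cast
      rw [hpq]
      linear_combination (↑q.den : ℝ) * hp + (↑p.den * Real.pi ^ 2 : ℝ) * hq
    have hb := (H _ _ _ hrel).2.1
    have hpd : p.den ≠ 0 := p.den_nz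
    have hqd : q.den ≠ 0 := q.den_nz
    have : (2 * p.den * q.den : ℕ) ≠ 0 := by positivity
    exact this (by exact_mod_cast hb)

/-- **The entry point of the printed proof.** To prove Theorem 1 it suffices to refute every
relation `a + b · L(2,χ₋₃)/2 + c · ζ(2)/4 = 0` (`a, b, c ∈ ℤ`) with `b ≠ 0`: the relations with
`b = 0` are already excluded by the irrationality of `π²` (`irrational_pi_sq`, Lindemann). This
is CDT §13's "suppose for the contradiction that there exists a `ℚ`-linear relation … (absurd)",
sharpened by the unconditional `π²`-slice. [cite: CalegariDimitrovTang2024, §13, eq. (absurd) (p. 106)] -/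
theorem linearIndependent_of_forall_int
    (H : ∀ a b c : ℤ, b ≠ 0 → (a : ℝ) + b * (L2chi3 / 2) + c * (Real.pi ^ 2 / 6 / 4) ≠ 0) :
    calegariDimitrovTang_linearIndependent := by
  rw [linearIndependent_iff_forall_int]
  intro a b c habc
  by_cases hb : b = 0
  · subst hb
    have h01 := eq_zero_of_add_mul_pi_sq_eq_zero a (c / 24) (by push_cast; linear_combination habc)
    refine ⟨by exact_mod_cast h01.1, rfl, ?_⟩
    have := h01.2
    simpa using this
  · exact absurd habc (H a b c hb)

end CalegariDimitrovTang

end Literature.NumberTheory.Transcendental
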